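import Summits.CriticalPhenomena.SAWScalingLimit.Theorems.SAWDevelopingMapObservableToSLETypeLadderCarvedReductionSqueezeZonesDef
import HarnessLib

/-!
# The window regions miss the cuts of the super-domain (piece (T-A′₂F gate cuts) of stub T-A′₂F
# `stub_carvedReduction_squeezeGeometry_domainsCoreF`)

Crux `SAWDevelopingMap.ObservableToSLE` (stmt-CriticalPhenomena-10472), line `six-class-type-ladder`,
stub T-A′₂F `stub_carvedReduction_squeezeGeometry_domainsCoreF`.  Landing target:
`Summits/CriticalPhenomena/SAWScalingLimit/Theorems/SAWDevelopingMapObservableToSLETypeLadderCarvedReductionSqueezeGateCuts.lean`.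

`gateV_disjoint_cuts`: the wide window region `gateV Pᵢ ρ t` (`t ≤ ρ/128`) misses both cuts
`L₀, L₁ ⊆ gateO ∪ frame ∪ {xx}` of the super-domain (`superSup`): its own gate's low box lies
deeper than `ρ/128`, its body zone is `ρ/4`-far from the open upper half-window, its exit region
is off `closure (D - τ)`, its frame is the boundary of the excluded box, its ends are on `∂J`; the
other gate's corridor is more than `2ρ` away.  Hence (`pathComponent_gateV_subset`) the path
component of the base point `Pᵢ + (ρ/16) i` in `gateV Pᵢ ρ t` lies in the super-domain `E`
(`JoinedIn` characterisation), and (`exists_mem_diff_bulk`) `E ∖ Ω` is nonempty (a strip point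
below the gate line, in the closed cells).
Registered carrier: `stub_carvedReduction_gateCuts`.
-/

noncomputable section

open scoped Topology
open Filter Set Metric
open Literature.Probability.RandomPlanarGeometry

namespace Summit.CriticalPhenomena.SAWScalingLimit.Theorems.ObservableToSLE.TypeLadder

/-- A point of `gateV P ρ t` (`t ≤ ρ/128`) is within `t` of... precisely: for every `ε' > 0` there is
a point of the open upper half-window of radius `ρ/2` within `t + ε'` of it. -/
theorem exists_window_point_near {P z : ℂ} {ρ t ε' : ℝ} (ht0 : 0 ≤ t) (ht : t ≤ ρ / 8) (hε : 0 < ε') (hε' : ε' ≤ ρ / 8)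
    (hz : z ∈ gateV P ρ t) : ∃ w ∈ {w : ℂ | P.im < w.im} ∩ ball P (ρ / 2), dist z w < t + ε' := by
  have hzP : dist z P < ρ / 4 := mem_ball.1 hz.1.1
  have hzlow : P.im - t < z.im := hz.1.2
  set u : ℝ := max (P.im - z.im) 0 + ε' / 2 with hu
  have hu0 : 0 < u := by have := le_max_right (P.im - z.im) 0; linarith
  have hut : u < t + ε' := by
    rcases le_or_gt (P.im - z.im) 0 with h | h
    · rw [hu, max_eq_right h]; linarith
    · rw [hu, max_eq_left h.le]; linarith
  refine ⟨z + ((u : ℝ) : ℂ) * Complex.I, ⟨?_, ?_⟩, ?_⟩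
  · show P.im < (z + ((u : ℝ) : ℂ) * Complex.I).im
    simp [hu]
    have := le_max_left (P.im - z.im) 0
    linarith
  · rw [mem_ball]
    have h1 : dist (z + ((u : ℝ) : ℂ) * Complex.I) z = u := by
      rw [dist_eq_norm, add_sub_cancel_left, norm_mul, Complex.norm_real, Complex.norm_I, mul_one, Real.norm_eq_abs, abs_of_pos hu0]
    have h2 : t ≤ ρ / 8 := ht
    linarith [dist_triangle (z + ((u : ℝ) : ℂ) * Complex.I) z P]
  · rw [dist_comm, dist_eq_norm, add_sub_cancel_left, norm_mul, Complex.norm_real, Complex.norm_I, mul_one, Real.norm_eq_abs,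
      abs_of_pos hu0]
    exact hut

/-- **THE WINDOW REGIONS MISS THE CUTS**; see the module docstring. -/
theorem gateV_disjoint_cuts {L F Bd : Fin 2 → Set ℂ} {xx : Fin 2 → Fin 2 → ℂ} {P α : Fin 2 → ℂ} {J Kd : Set ℂ} {ρ R t : ℝ}
    (hρ : 0 < ρ) (ht0 : 0 ≤ t) (ht : t ≤ ρ / 128) (hJ : IsOpen J)
    (hL : ∀ i, L i ⊆ gateO (Bd i) (F i) (P i) ρ ∪
      (segment ℝ (P i - ((ρ / 64 : ℝ) : ℂ) - ((ρ / 128 : ℝ) : ℂ) * Complex.I) (P i - ((ρ / 64 : ℝ) : ℂ)) ∪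
        segment ℝ (P i - ((ρ / 64 : ℝ) : ℂ)) (P i + ((ρ / 64 : ℝ) : ℂ)) ∪
        segment ℝ (P i + ((ρ / 64 : ℝ) : ℂ)) (P i + ((ρ / 64 : ℝ) : ℂ) - ((ρ / 128 : ℝ) : ℂ) * Complex.I)) ∪
      {xx i 0, xx i 1})
    (hxx : ∀ i k, xx i k ∈ frontier J) (hKdJ : Kd ⊆ J) (hballs : ∀ i, ball (P i) (ρ / 2) ⊆ Kd)
    (hFK : ∀ i, Disjoint (F i) Kd)
    (hBfar : ∀ i, ∀ bb ∈ Bd i, ∀ z : ℂ, dist z (P i) < ρ / 2 → (P i).im < z.im → ρ / 4 ≤ dist bb z)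
    (hBne : ∀ i, (Bd i).Nonempty) (hBR : ∀ i, Bd i ⊆ closedBall (α i) R) (hPα : ∀ i, dist (P i) (α i) ≤ R)
    (hsep : 2 * (R + ρ) < dist (α 0) (α 1)) (i : Fin 2) : Disjoint (gateV (P i) ρ t) (L 0 ∪ L 1) := by
  rw [disjoint_left]
  intro z hz hzL
  have hzP : dist z (P i) < ρ / 4 := mem_ball.1 hz.1.1
  have hzlow : (P i).im - t < z.im := hz.1.2
  have hzKd : z ∈ Kd := hballs i (mem_ball.2 (by linarith))
  -- the other gate is far
  have hother : ∀ k, k ≠ i → R + 7 * ρ / 4 < dist z (α k) := by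
    intro k hk
    have hik : dist (α i) (α k) = dist (α 0) (α 1) := by
      fin_cases i <;> fin_cases k
      · exact absurd rfl hk
      · rfl
      · exact dist_comm _ _
      · exact absurd rfl hk
    linarith [dist_triangle (α i) z (α k), dist_triangle (α i) (P i) z, dist_comm (P i) (α i), dist_comm z (P i), hPα i]
  -- case analysis on the cut
  have key : ∀ k, z ∈ L k → False := by
    intro k hzk
    rcases hL k hzk with (hO | hfr) | hx
    · rcases hO with (⟨⟨hre, h1, h2⟩, -⟩ | hbody) | hFk
      · -- low box of gate `k`
        by_cases hk : k = i
        · subst hk; linarith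
        · have h3 : dist z (P k) < ρ / 2 := by
            rw [dist_eq_norm]
            refine (Complex.norm_le_abs_re_add_abs_im _).trans_lt ?_
            rw [Complex.sub_re, Complex.sub_im]
            have : |z.im - (P k).im| < 7 * ρ / 16 := by rw [abs_lt]; constructor <;> linarith
            linarith
          linarith [hother k hk, dist_triangle z (P k) (α k), hPα k]
      · -- body zone of gate `k`
        have hbody' : infDist z (Bd k) < ρ / 8 := hbody
        by_cases hk : k = i
        · subst hk
          obtain ⟨w, hw, hzw⟩ := exists_window_point_near (P := P k) ht0 (by linarith) (show (0 : ℝ) < ρ / 128 by positivity)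
            (by linarith) hz
          obtain ⟨bb, hbb, hbz⟩ := (infDist_lt_iff (hBne k)).1 hbody'
          have h1 := hBfar k bb hbb w (mem_ball.1 hw.2) hw.1
          rw [dist_comm] at hbz
          linarith [dist_triangle bb z w]
        · obtain ⟨bb, hbb, hbz⟩ := (infDist_lt_iff (hBne k)).1 hbody'
          have h1 := mem_closedBall.1 (hBR k hbb)
          linarith [hother k hk, dist_triangle z bb (α k)]
      · exact disjoint_left.1 (hFK k) hFk hzKd
    · -- the frame of gate `k`
      have h1 := frame_subset_rect (g := P k) (ρ' := ρ / 64) (h := ρ / 128) (by positivity) (by positivity) hfr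
      by_cases hk : k = i
      · subst hk; exact hz.2 h1
      · obtain ⟨hre, h2, h3⟩ := h1
        have h4 : dist z (P k) < ρ / 2 := by
          rw [dist_eq_norm]
          refine (Complex.norm_le_abs_re_add_abs_im _).trans_lt ?_
          rw [Complex.sub_re, Complex.sub_im]
          have : |z.im - (P k).im| ≤ ρ / 128 := by rw [abs_le]; constructor <;> linarith
          linarith
        linarith [hother k hk, dist_triangle z (P k) (α k), hPα k]
    · have hzfr : z ∈ frontier J := by
        rcases hx with rfl | rfl
        · exact hxx k 0
        · exact hxx k 1
      exact hzfr.2 (by rw [hJ.interior_eq]; exact hKdJ hzKd)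
  rcases hzL with h | h
  · exact key 0 h
  · exact key 1 h

/-- **The path component of the base point in the window region lies in the super-domain**
(`JoinedIn` characterisation of `E`, `E` open connected containing the window). -/
theorem pathComponent_gateV_subset {E J Cut : Set ℂ} {P : ℂ} {b₀ : ℂ} {ρ t : ℝ}
    (hV : Disjoint (gateV P ρ t) Cut) (hVJ : gateV P ρ t ⊆ J) (hjoin : ∀ z : ℂ, JoinedIn (J \ Cut) z b₀ → z ∈ E)
    (hE : IsOpen E) (hEc : IsConnected E) (hEJ : E ⊆ J \ Cut) (hb₀ : b₀ ∈ E) (hbase : P + ((ρ / 16 : ℝ) : ℂ) * Complex.I ∈ E) :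
    pathComponentIn (gateV P ρ t) (P + ((ρ / 16 : ℝ) : ℂ) * Complex.I) ⊆ E := by
  intro z hz
  have h1 : JoinedIn (J \ Cut) (P + ((ρ / 16 : ℝ) : ℂ) * Complex.I) z :=
    (show JoinedIn (gateV P ρ t) _ z from hz).mono fun w hw => ⟨hVJ hw, disjoint_left.1 hV hw⟩
  have h2 : JoinedIn (J \ Cut) (P + ((ρ / 16 : ℝ) : ℂ) * Complex.I) b₀ :=
    ((hE.isConnected_iff_isPathConnected.1 hEc).joinedIn _ hbase _ hb₀).mono hEJ
  exact hjoin z (h1.symm.trans h2)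

/-- **Registered carrier `stub_carvedReduction_gateCuts`** (crux item stmt-CriticalPhenomena-10472, stub
T-A′₂F `stub_carvedReduction_squeezeGeometry_domainsCoreF`, piece THE GATE CUTS): the path component
of the base point in the window region lies in the super-domain. -/
theorem stub_carvedReduction_gateCuts :
    ∀ (E J Cut : Set ℂ) (P b₀ : ℂ) (ρ t : ℝ), Disjoint (gateV P ρ t) Cut → gateV P ρ t ⊆ J →
      (∀ z : ℂ, JoinedIn (J \ Cut) z b₀ → z ∈ E) → IsOpen E → IsConnected E → E ⊆ J \ Cut → b₀ ∈ E →
      P + ((ρ / 16 : ℝ) : ℂ) * Complex.I ∈ E → pathComponentIn (gateV P ρ t) (P + ((ρ / 16 : ℝ) : ℂ) * Complex.I) ⊆ E :=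
  fun _ _ _ _ _ _ _ hV hVJ hjoin hE hEc hEJ hb₀ hbase => pathComponent_gateV_subset hV hVJ hjoin hE hEc hEJ hb₀ hbase

end Summit.CriticalPhenomena.SAWScalingLimit.Theorems.ObservableToSLE.TypeLadder

end
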